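import Summits.Ventures.HSemireg.WedgeHankelBoxSiegelIdealMiddle
import Summits.Ventures.HSemireg.WedgeHankelBoxSiegelIdealGenFun

/-!
# Venture HSemireg — THE BOX SIEGEL IDEAL: the PER-BLOCK RANK of the box of middle powers — on the Dolbeault block `H^b(⋀^a T_Y)` the contraction against
# `Θ₀^{p₀}/p₀! ⊠ ⋯ ⊠ Θ_{n−1}^{p_{n−1}}/p_{n−1}!` (`a+b ≤ p_i ≤ m_i − (a+b)`) has rank = the number of box-standard monomials of bidegree `(a,b)` = `[v^b u^a] Π_i Q_{m_i}`

HONEST FRAMING. Part of the Lean index of the computation cell `pub-hsemireg` (seat p10 gen 12, Sunday typer «UNIFORM-IN-n»).  Finite-dimensional EXTERIOR ALGEBRA over a field ONLY;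
nothing here says that HC / HC_CM / HC_AV holds; no Literature fact is declared or used.  Dictionary (`plane₂ a b` ↦ `H^b(⋀^a T_Y)`; `δ_p ↦ Θ^p/p!`) QUOTED, never asserted.

THIS FILE (namespace `Summit.Ventures.HSemireg.Wedge.HankelBoxSiegelIdeal` continued; imports `…Middle` (v1.1) and `…GenFun`): for the box `F` of middle powers the kernel of `θ ↦ θ ∧ F` on
`⋀^k` is `boxSiegelIdeal_k` (Middle), so on each block `plane₂ a b` (`a + b = k`) the kernel of the restricted map is `boxSiegelIdeal_k ∩ plane₂ a b` (`ker_mulRight_inf_plane₂`) and, by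
rank–nullity on the block and the Dolbeault-type count (PlanesCount / GenFun), **`finrank_map_plane₂_middleBox`: `rank(θ ↦ θ ∧ F ∣ plane₂ a b) = #{box-standard monomials of bidegree (a,b)}`**
and **`finrank_map_plane₂_middleBox_eq_coeff`: `= [v^b u^a] Π_i slotPoly m_i`** (one factor, gen 11 #7: the per-block rank `C(n,k)` of a class with non-zero window; here for the box of middle
powers every block attains its generic rank).  NOT typed: per-block ranks of OTHER boxes (images of different blocks overlap in general); anything Ext-side.  Class side only.
-/

open Module

namespace Summit.Ventures.HSemireg.Wedge.HankelBoxSiegelIdeal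

open Summit.Ventures.HSemireg.Wedge Summit.Ventures.HSemireg.Wedge.Kunneth Summit.Ventures.HSemireg.Wedge.MixedBox
  Summit.Ventures.HSemireg.Wedge.HankelBox

variable (K : Type*) [Field K] {n : ℕ} (m : Fin n → ℕ)

/-- on a block of total degree `k`, the kernel of right multiplication by a Hankel box whose degree-`k` kernel is the box Siegel ideal is `boxSiegelIdeal_k ∩ plane₂ a b`. -/
theorem ker_mulRight_inf_plane₂ {k a b : ℕ} (hab : a + b = k) {F : HT K (Gen m)}
    (hF : LinearMap.ker (wedge K (Gen m) k F) = (boxSiegelIdeal K m k).comap (⋀[K]^k (Gen m → K)).subtype) :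
    LinearMap.ker (LinearMap.mulRight K F) ⊓ plane₂ K m a b = boxSiegelIdeal K m k ⊓ plane₂ K m a b := by
  ext θ
  simp only [Submodule.mem_inf, LinearMap.mem_ker, LinearMap.mulRight_apply]
  constructor
  · rintro ⟨h0, hθ⟩
    have hk : θ ∈ ⋀[K]^k (Gen m → K) := by rw [← hab]; exact plane₂_le_exteriorPower K m a b hθ
    have hker : (⟨θ, hk⟩ : ⋀[K]^k (Gen m → K)) ∈ LinearMap.ker (wedge K (Gen m) k F) := by
      rw [LinearMap.mem_ker, wedge, LinearMap.comp_apply, Submodule.subtype_apply, LinearMap.mulRight_apply]; exact h0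
    rw [hF] at hker
    exact ⟨hker, hθ⟩
  · rintro ⟨hJ, hθ⟩
    have hk : θ ∈ ⋀[K]^k (Gen m → K) := by rw [← hab]; exact plane₂_le_exteriorPower K m a b hθ
    have hker : (⟨θ, hk⟩ : ⋀[K]^k (Gen m → K)) ∈ (boxSiegelIdeal K m k).comap (⋀[K]^k (Gen m → K)).subtype := hJ
    rw [← hF, LinearMap.mem_ker, wedge, LinearMap.comp_apply, Submodule.subtype_apply, LinearMap.mulRight_apply] at hker
    exact ⟨hker, hθ⟩

/-- rank–nullity on a block: `rank(θ ↦ θ ∧ F ∣ plane₂ a b) + dim(ker ∩ plane₂ a b) = dim plane₂ a b`. -/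
lemma finrank_map_plane₂_add (F : HT K (Gen m)) (a b : ℕ) :
    finrank K ((plane₂ K m a b).map (LinearMap.mulRight K F)) + finrank K ↥(LinearMap.ker (LinearMap.mulRight K F) ⊓ plane₂ K m a b) =
      finrank K (plane₂ K m a b) := by
  have h := LinearMap.finrank_range_add_finrank_ker ((LinearMap.mulRight K F).domRestrict (plane₂ K m a b))
  rw [LinearMap.range_domRestrict, LinearMap.ker_domRestrict] at h
  rw [← h, inf_comm]
  congr 1
  exact (Submodule.comapSubtypeEquivOfLe (inf_le_left : plane₂ K m a b ⊓ LinearMap.ker (LinearMap.mulRight K F) ≤ plane₂ K m a b)).finrank_eq.symm ▸ by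
    rw [Submodule.comap_inf, Submodule.comap_subtype_self, top_inf_eq]

/-- **THE PER-BLOCK RANK OF A BOX WITH KERNEL `boxSiegelIdeal_k`** (e.g. the box of middle powers): on `plane₂ a b`, `a + b = k`, the rank of `θ ↦ θ ∧ F` is the number of
box-standard monomials of bidegree `(a, b)`. -/
theorem finrank_map_plane₂_of_ker_eq {k a b : ℕ} (hab : a + b = k) {F : HT K (Gen m)}
    (hF : LinearMap.ker (wedge K (Gen m) k F) = (boxSiegelIdeal K m k).comap (⋀[K]^k (Gen m → K)).subtype) :
    finrank K ((plane₂ K m a b).map (LinearMap.mulRight K F)) = Fintype.card {f : BIdx m n (a + b) // xdeg m f.1 = a ∧ ydeg m f.1 = b} := by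
  subst hab
  have h1 := finrank_map_plane₂_add K m F a b
  rw [ker_mulRight_inf_plane₂ K m rfl hF] at h1
  have h2 := finrank_boxSiegelIdeal_inf_plane₂ K m a b
  rw [← finrank_plane₂ K m a b] at h2
  omega

/-- **THE BOX OF MIDDLE POWERS, BLOCK BY BLOCK: for `n ≥ 1` and `a + b ≤ p_i ≤ m_i − (a+b)` (all `i`), `rank(θ ↦ θ ∧ (E_{p₀} ∧ ⋯ ∧ E_{p_{n−1}}) ∣ plane₂ a b) = #{box-standard monomials of
bidegree (a,b)}`.** -/
theorem finrank_map_plane₂_middleBox (hn : 1 ≤ n) {a b : ℕ} {p : Fin n → ℕ} (hp : ∀ i, a + b ≤ p i ∧ p i + (a + b) ≤ m i) :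
    finrank K ((plane₂ K m a b).map (LinearMap.mulRight K (hankelBox K m fun i => fun j => if j = p i then (1 : K) else 0))) =
      Fintype.card {f : BIdx m n (a + b) // xdeg m f.1 = a ∧ ydeg m f.1 = b} :=
  finrank_map_plane₂_of_ker_eq K m rfl (ker_wedge_middleBox_eq K m hn hp)

/-- … **`= [v^b u^a] Π_i slotPoly m_i`** (the bivariate generating function of GenFun; `[v^c u^d] slotPoly m = C(m, c+d)`). -/
theorem finrank_map_plane₂_middleBox_eq_coeff (hn : 1 ≤ n) {a b : ℕ} {p : Fin n → ℕ} (hp : ∀ i, a + b ≤ p i ∧ p i + (a + b) ≤ m i) :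
    finrank K ((plane₂ K m a b).map (LinearMap.mulRight K (hankelBox K m fun i => fun j => if j = p i then (1 : K) else 0))) =
      ((∏ i : Fin n, slotPoly (m i)).coeff b).coeff a := by
  rw [finrank_map_plane₂_middleBox K m hn hp, card_bideg_eq_coeff]

end Summit.Ventures.HSemireg.Wedge.HankelBoxSiegelIdeal
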